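import Summits.BirchSwinnertonDyer.BirchSwinnertonDyer.Theorems.ManinLocalTwoThreeSymbolLemmaGBottom
import HarnessLib

/-!
# Odd shifts reduce to the single shift at symbol level: a cusp map invariant under `Γ₀(tᵏL')` and `diag(tⁿ,1)`, `n` odd,
# is invariant under `diag(t,1)` (E-es-38 `OddShiftReduction`, symbol half; MEMO-es §25)

Summit `BirchSwinnertonDyer`, route `ManinLocalTwoThree` (cell bsd-f2-manin), crux C2 `ManinOddAtFour` (stmt-BirchSwinnertonDyer-22967),
registered stub `stub_cThreeImageResidual` (the 3 950 `C₃`-image classes) — the planner's new line MEMO-es §25 («Bass–Serre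
descent», es g12) for it lists E-es-38 `OddShiftReduction`: for odd `n`, `tⁿ`-shift invariance reduces to `t`-shift invariance
because `A = Aⁿ·(A²)^{−(n−1)/2}` and `A² = diag(t²,1) ≡ diag(t, t⁻¹) ∈ Δ_t(L')` modulo scalars, which lies in the
`Ad(A^{±n})`-closure by LEMMA G (p1, p600663).  This file proves the SYMBOL-LEVEL statement (also relevant to crux C3
stmt-BirchSwinnertonDyer-22968 through the same leaf family):

* `scalar_smul_onePoint` — scalar matrices act trivially on `P¹(ℚ)`;
* `invariant_diag_sq_of_invariant_delta` — invariance under `j(Δ_t(L'))` gives invariance under `diag(t², 1)`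
  (`= t · j(diag(t, t⁻¹))`, `diagP t ∈ Δ_t(L')`);
* **`invariant_diag_of_invariant_diag_pow_odd`** — for `t` prime, `n` odd, `t ∤ L'`: a cusp map invariant under `Γ₀(tᵏL')`
  and under `diag(tⁿ, 1)` is invariant under `diag(t, 1)` (`delta_le_symbolStabilizer`, p3, + the two items above).

Nothing about BSD or Manin's conjecture is proved here.  References: HOME/MEMO-es.md §25 (E-es-38), §23.1 (LEMMA G).
-/

set_option autoImplicit false
set_option linter.dupNamespace false

open scoped MatrixGroups

open CongruenceSubgroup Matrix.SpecialLinearGroup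
  Summit.BirchSwinnertonDyer.BirchSwinnertonDyer.Theorems.ConjSpanGenAllLevels

namespace Summit.BirchSwinnertonDyer.BirchSwinnertonDyer.Theorems.ManinLocalTwoThree

noncomputable section

/-! ### §1  Scalars act trivially on `P¹(ℚ)` -/

/-- Two elements of `GL₂(ℚ)` whose matrices differ by a nonzero scalar act identically on `P¹(ℚ)`. [folklore] -/
theorem smul_eq_of_coe_eq_smul {g h : GL (Fin 2) ℚ} {c : ℚ} (hc : c ≠ 0)
    (hgh : (g : Matrix (Fin 2) (Fin 2) ℚ) = c • (h : Matrix (Fin 2) (Fin 2) ℚ)) (x : OnePoint ℚ) : g • x = h • x := by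
  have e : ∀ i j, (g : Matrix (Fin 2) (Fin 2) ℚ) i j = c * (h : Matrix (Fin 2) (Fin 2) ℚ) i j := fun i j => by
    rw [hgh]; rfl
  cases x with
  | infty =>
    rw [OnePoint.smul_infty_eq_ite, OnePoint.smul_infty_eq_ite]
    simp only [e, mul_eq_zero, hc, false_or]
    split_ifs with h1
    · rfl
    · rw [mul_div_mul_left _ _ hc]
  | coe k =>
    rw [OnePoint.smul_some_eq_ite, OnePoint.smul_some_eq_ite]
    simp only [e]
    have e2 : c * (h : Matrix (Fin 2) (Fin 2) ℚ) 1 0 * k + c * (h : Matrix (Fin 2) (Fin 2) ℚ) 1 1 =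
        c * ((h : Matrix (Fin 2) (Fin 2) ℚ) 1 0 * k + (h : Matrix (Fin 2) (Fin 2) ℚ) 1 1) := by ring
    have e3 : c * (h : Matrix (Fin 2) (Fin 2) ℚ) 0 0 * k + c * (h : Matrix (Fin 2) (Fin 2) ℚ) 0 1 =
        c * ((h : Matrix (Fin 2) (Fin 2) ℚ) 0 0 * k + (h : Matrix (Fin 2) (Fin 2) ℚ) 0 1) := by ring
    rw [e2, e3]
    simp only [mul_eq_zero, hc, false_or]
    split_ifs with h1
    · rfl
    · rw [mul_div_mul_left _ _ hc]

/-! ### §2  `diag(t², 1)` from `Δ_t(L')`-invariance; odd powers -/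

section Odd

variable {t n k L' : ℕ} [NeZero t] {K : Type*}

/-- **Odd shift reduction at symbol level.**  For `t` prime, `n` odd, `t ∤ L'`: a cusp map invariant under `Γ₀(tᵏ L')`
and under `A` with matrix `diag(tⁿ, 1)` is invariant under every `A₁` with matrix `diag(t, 1)`.  Proof: LEMMA G gives
invariance under `j(diag(t, t⁻¹))`, whose matrix is `t⁻¹ · diag(t², 1) = t⁻¹ · A₁²`; so `A₁²` acts like an invariant
element, and `A₁ = A · (A₁²)^{-(n-1)/2}` up to the scalar-free identity `A = A₁ⁿ`. [folklore] -/
theorem invariant_diag_of_invariant_diag_pow_odd (htp : t.Prime) (hn : Odd n) (hL' : ¬ t ∣ L')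
    (Φ : OnePoint ℚ → OnePoint ℚ → K)
    (A : GL (Fin 2) ℚ) (hA : (A : Matrix (Fin 2) (Fin 2) ℚ) = !![((t : ℚ) ^ n), 0; 0, 1])
    (A₁ : GL (Fin 2) ℚ) (hA₁ : (A₁ : Matrix (Fin 2) (Fin 2) ℚ) = !![(t : ℚ), 0; 0, 1])
    (hinv : ∀ γ : Gamma0 (t ^ k * L'), ∀ a b, Φ (mapGL ℚ (γ : SL(2, ℤ)) • a) (mapGL ℚ (γ : SL(2, ℤ)) • b) = Φ a b)
    (hAinv : ∀ a b, Φ (A • a) (A • b) = Φ a b) :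
    ∀ a b, Φ (A₁ • a) (A₁ • b) = Φ a b := by
  obtain ⟨m, rfl⟩ := hn
  -- the canonical embedding `j = toGL ∘ SL₂(f)`, `f : ℤ[1/t] → ℚ`
  have hunit : IsUnit ((Int.castRingHom ℚ) (t : ℤ)) := by
    rw [eq_intCast, Int.cast_natCast]; exact isUnit_iff_ne_zero.2 (Nat.cast_ne_zero.2 htp.ne_zero)
  let f : Away t →+* ℚ := IsLocalization.Away.lift (S := Away t) (t : ℤ) (g := Int.castRingHom ℚ) hunit
  have hft : f (algebraMap ℤ (Away t) (t : ℤ)) = t :=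
    (IsLocalization.Away.lift_eq (S := Away t) (t : ℤ) hunit (t : ℤ)).trans (by rw [eq_intCast, Int.cast_natCast])
  have hfinv : f (IsLocalization.Away.invSelf (t : ℤ)) = (t : ℚ)⁻¹ := by
    have h1 : f (algebraMap ℤ (Away t) (t : ℤ)) * f (IsLocalization.Away.invSelf (t : ℤ)) = 1 := by
      rw [← map_mul, IsLocalization.Away.mul_invSelf, map_one]
    rw [hft] at h1
    exact (eq_inv_of_mul_eq_one_right h1)
  -- LEMMA G: invariance under `j(Δ_t(L'))`, in particular under `j(diag(t, t⁻¹))`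
  have hΔ := delta_le_symbolStabilizer f A hA htp (by omega) hL' Φ hinv hAinv
  have hP : diagP t ∈ Delta t L' := upperB_le_Delta (by show (diagP t) 1 0 = 0; rfl)
  have hdiag := hΔ (diagP t) hP
  -- `A₁² = t · j(diag(t, t⁻¹))` as matrices, so they act identically
  have hsq : ∀ x : OnePoint ℚ, (A₁ ^ 2) • x = ((toGL : SL(2, ℚ) →* GL (Fin 2) ℚ).comp (map f) (diagP t)) • x := by
    intro x
    refine smul_eq_of_coe_eq_smul (c := (t : ℚ)) (Nat.cast_ne_zero.2 htp.ne_zero) ?_ x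
    rw [pow_two, Units.val_mul, hA₁]
    ext i j
    fin_cases i <;> fin_cases j <;>
      simp [Matrix.mul_apply, Fin.sum_univ_two, diagP, hfinv, htp.ne_zero]
  have hsqinv : ∀ a b, Φ ((A₁ ^ 2) • a) ((A₁ ^ 2) • b) = Φ a b := by
    intro a b; rw [hsq, hsq]; exact hdiag a b
  -- `A = A₁^(2m+1)`: equal matrices
  have hAeq : A = A₁ ^ (2 * m + 1) := by
    apply Matrix.GeneralLinearGroup.ext
    intro i j
    have hpow : ∀ e : ℕ, ((A₁ ^ e : GL (Fin 2) ℚ) : Matrix (Fin 2) (Fin 2) ℚ) = !![(t : ℚ) ^ e, 0; 0, 1] := by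
      intro e
      induction e with
      | zero => rw [pow_zero]; ext i j; fin_cases i <;> fin_cases j <;> rfl
      | succ e ih =>
        rw [pow_succ, Units.val_mul, ih, hA₁]
        ext i j; fin_cases i <;> fin_cases j <;> simp [Matrix.mul_apply, Fin.sum_univ_two, pow_succ]
    rw [hA, hpow]
  -- `A₁ = A · ((A₁²)^m)⁻¹`
  have hA₁eq : A₁ = A * ((A₁ ^ 2) ^ m)⁻¹ := by
    rw [hAeq, ← pow_mul, pow_succ', mul_inv_cancel_right]
  -- invariance under every power of `A₁²`
  have hpm : ∀ (e : ℕ) (a b : OnePoint ℚ), Φ (((A₁ ^ 2) ^ e) • a) (((A₁ ^ 2) ^ e) • b) = Φ a b := by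
    intro e
    induction e with
    | zero => intro a b; simp
    | succ e ih => intro a b; rw [pow_succ, mul_smul, mul_smul, ih, hsqinv]
  intro a b
  rw [hA₁eq, mul_smul, mul_smul, hAinv]
  exact cuspSymbol_invariant_inv Φ (hpm m) a b

end Odd

end

end Summit.BirchSwinnertonDyer.BirchSwinnertonDyer.Theorems.ManinLocalTwoThree
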